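import Mathlib.Analysis.SpecialFunctions.Pow.Real
import Mathlib.Analysis.SpecialFunctions.Sqrt
import HarnessLib

/-!
# Crux `PercNonProliferation.FreeBoxSparse` (stmt-CriticalPhenomena-4445), line `ccfs-window-kissing-walls` —
# the exponent bookkeeping of the `stub_collar` assembly (lead's helper, part 2; registered sub-goal `stub_collar_arith`)

Pure real arithmetic. With `N = |Λ| ≥ 1`, `σ > 0`, `A = 8L³ ≥ 1`, `q = p^u ∈ (0,1]`, and the two largeness
conditions `A² ≤ N`, `A²/q ≤ N^σ`, the grid length `L₀ = ⌊N^{σ/2}⌋` and the good-unit threshold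
`m₀ = ⌈N^{1/2+σ}/A⌉` satisfy `1 ≤ L₀ ≤ m₀`, `1/L₀ ≤ 2 N^{-σ/2}`, and every grid level `s = k/m₀`, `k < L₀`,
lies in `[0,1]`, is inside the CCFS window (`N s² ≤ q`) and gives a total-variation term
`s √(N/q) ≤ (A/√q) N^{-σ/2}`.
-/

noncomputable section

namespace Summit.CriticalPhenomena.PercolationContinuityZ3.Theorems.FreeBoxSparse

namespace StubCollarAssembly

/-- `N^{1/2+σ} = √N · (N^{σ/2})²` for `N > 0`. [folklore] -/
theorem rpow_half_add_eq {N σ : ℝ} (hN : 0 < N) :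
    N ^ ((1 : ℝ) / 2 + σ) = Real.sqrt N * (N ^ (σ / 2)) ^ 2 := by
  rw [Real.rpow_add hN, Real.sqrt_eq_rpow]
  congr 1
  rw [← Real.rpow_natCast, ← Real.rpow_mul hN.le]
  norm_num

/-- **The exponent bookkeeping of the collar assembly.** [folklore] -/
theorem collar_arith {N σ A q x : ℝ} {L₀ m₀ : ℕ} (hN : 1 ≤ N) (hσ : 0 < σ) (hA : 1 ≤ A) (hq0 : 0 < q)
    (hNA : A ^ 2 ≤ N) (hNB : A ^ 2 / q ≤ N ^ σ) (hx : x = N ^ (σ / 2)) (hL : L₀ = ⌊x⌋₊)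
    (hm : m₀ = ⌈N ^ ((1 : ℝ) / 2 + σ) / A⌉₊) :
    1 ≤ L₀ ∧ L₀ ≤ m₀ ∧ 1 / (L₀ : ℝ) ≤ 2 * N ^ (-(σ / 2)) ∧
      ∀ k : ℕ, k < L₀ → 0 ≤ (k : ℝ) / m₀ ∧ (k : ℝ) / m₀ ≤ 1 ∧ N * ((k : ℝ) / m₀) ^ 2 ≤ q ∧
        (k : ℝ) / m₀ * Real.sqrt (N / q) ≤ A / Real.sqrt q * N ^ (-(σ / 2)) := by
  have hN0 : 0 < N := by linarith
  have hA0 : 0 < A := by linarith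
  -- `x = N^{σ/2} ≥ 1`, `y = √N ≥ A`
  have hx1 : 1 ≤ x := by rw [hx]; exact Real.one_le_rpow hN (by positivity)
  have hx0 : 0 < x := by linarith
  set y := Real.sqrt N with hy
  have hy2 : y ^ 2 = N := Real.sq_sqrt hN0.le
  have hy0 : 0 < y := Real.sqrt_pos.2 hN0
  have hyA : A ≤ y := by
    rw [hy, Real.le_sqrt hA0.le hN0.le]; exact hNA
  -- `N^σ = x²`, `N^{1/2+σ} = y x²`, `N^{-σ/2} = x⁻¹`
  have hxsq : N ^ σ = x ^ 2 := by
    rw [hx, ← Real.rpow_natCast, ← Real.rpow_mul hN0.le]; norm_num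
  have hV : N ^ ((1 : ℝ) / 2 + σ) = y * x ^ 2 := by rw [rpow_half_add_eq hN0, ← hx]
  have hxinv : N ^ (-(σ / 2)) = x⁻¹ := by rw [Real.rpow_neg hN0.le, ← hx]
  have hAq : A ^ 2 ≤ q * x ^ 2 := by
    rw [← hxsq]; rwa [div_le_iff₀' hq0] at hNB
  -- `L₀`
  have hL1 : 1 ≤ L₀ := by rw [hL]; exact (Nat.one_le_floor_iff x).2 hx1
  have hLx : (L₀ : ℝ) ≤ x := by rw [hL]; exact Nat.floor_le hx0.le
  have hxL : x < (L₀ : ℝ) + 1 := by rw [hL]; exact Nat.lt_floor_add_one x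
  have hL0 : (0 : ℝ) < L₀ := by exact_mod_cast hL1
  have hLhalf : x ≤ 2 * (L₀ : ℝ) := by
    have : (1 : ℝ) ≤ L₀ := by exact_mod_cast hL1
    linarith
  -- `m₀`
  have hmV : y * x ^ 2 / A ≤ (m₀ : ℝ) := by rw [hm, ← hV]; exact Nat.le_ceil _
  have hxm : x ≤ y * x ^ 2 / A := by
    rw [le_div_iff₀ hA0]
    have h1 : A * x ≤ y * x := mul_le_mul_of_nonneg_right hyA hx0.le
    have h2 : y * x ≤ y * x ^ 2 := by
      have : x ≤ x ^ 2 := by nlinarith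
      exact mul_le_mul_of_nonneg_left this hy0.le
    linarith
  have hLm : (L₀ : ℝ) ≤ m₀ := hLx.trans (hxm.trans hmV)
  have hm0 : (0 : ℝ) < m₀ := hL0.trans_le hLm
  refine ⟨hL1, by exact_mod_cast hLm, ?_, ?_⟩
  · -- `1/L₀ ≤ 2 x⁻¹`
    rw [hxinv, div_le_iff₀ hL0]
    have : 2 * x⁻¹ * (L₀ : ℝ) = 2 * L₀ / x := by ring
    rw [this, le_div_iff₀ hx0]
    linarith
  · intro k hk
    have hkL : (k : ℝ) ≤ L₀ := by exact_mod_cast hk.le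
    have hk0 : (0 : ℝ) ≤ k := Nat.cast_nonneg k
    set s := (k : ℝ) / m₀ with hs
    have hs0 : 0 ≤ s := div_nonneg hk0 hm0.le
    have hs1 : s ≤ 1 := by
      rw [hs, div_le_one hm0]; exact hkL.trans hLm
    -- `s ≤ A/(y x)`
    have hsb : s ≤ A / (y * x) := by
      rw [hs, div_le_div_iff₀ hm0 (by positivity)]
      calc (k : ℝ) * (y * x) ≤ x * (y * x) := by gcongr; exact hkL.trans hLx
        _ = A * (y * x ^ 2 / A) := by field_simp
        _ ≤ A * (m₀ : ℝ) := by gcongr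
    refine ⟨hs0, hs1, ?_, ?_⟩
    · -- window: `N s² ≤ y² A²/(y x)² = A²/x² ≤ q`
      calc N * s ^ 2 ≤ N * (A / (y * x)) ^ 2 := by gcongr
        _ = A ^ 2 / x ^ 2 := by rw [← hy2]; field_simp
        _ ≤ q := by rw [div_le_iff₀ (by positivity)]; exact hAq
    · -- TV term: `s √(N/q) = s y/√q ≤ A/(x √q)`
      have hsq : Real.sqrt (N / q) = y / Real.sqrt q := by rw [hy, Real.sqrt_div' N hq0.le]
      have hq' : 0 < Real.sqrt q := Real.sqrt_pos.2 hq0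
      rw [hsq, hxinv]
      calc s * (y / Real.sqrt q) ≤ A / (y * x) * (y / Real.sqrt q) := by gcongr
        _ = A / Real.sqrt q * x⁻¹ := by field_simp

end StubCollarAssembly


/-- **Registered sub-goal `stub_collar_arith`** (lead, line `ccfs-window-kissing-walls`): the exponent bookkeeping
of the collar assembly — `StubCollarAssembly.collar_arith` verbatim. [folklore] -/
theorem stub_collar_arith : ∀ {N σ A q x : ℝ} {L₀ m₀ : ℕ}, 1 ≤ N → 0 < σ → 1 ≤ A → 0 < q → A ^ 2 ≤ N → A ^ 2 / q ≤ N ^ σ → x = N ^ (σ / 2) → L₀ = ⌊x⌋₊ → m₀ = ⌈N ^ ((1 : ℝ) / 2 + σ) / A⌉₊ → 1 ≤ L₀ ∧ L₀ ≤ m₀ ∧ 1 / (L₀ : ℝ) ≤ 2 * N ^ (-(σ / 2)) ∧ ∀ k : ℕ, k < L₀ → 0 ≤ (k : ℝ) / m₀ ∧ (k : ℝ) / m₀ ≤ 1 ∧ N * ((k : ℝ) / m₀) ^ 2 ≤ q ∧ (k : ℝ) / m₀ * Real.sqrt (N / q) ≤ A / Real.sqrt q * N ^ (-(σ / 2)) 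:=
  fun hN hσ hA hq0 hNA hNB hx hL hm => StubCollarAssembly.collar_arith hN hσ hA hq0 hNA hNB hx hL hm

end Summit.CriticalPhenomena.PercolationContinuityZ3.Theorems.FreeBoxSparse

end
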